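import Literature.NumberTheory.Sieve.MaynardSieveTuples
import HarnessLib

/-!
# Maynard–Tao sieve: the kernel of the quadratic form and its factorisation over primes

J. Maynard, *Small gaps between primes*, Ann. of Math. (2) 181 (2015), 383–413 = arXiv:1311.4600,
proofs of Lemmas 5.1 and 5.2: after the Chinese remainder theorem, `S₁` and `S₂^{(m)}` become
`∑_{d, e} λ_d λ_e / f([d, e])` with `f(q) = q` resp. `φ(q)`, and substituting
`λ_d = (∏ μ(dᵢ) dᵢ) ∑_{d ∣ r} y_r / ∏ φ(rᵢ)` ((5.8), (6.3)) turns them into quadratic forms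
`∑_{r, s} y_r y_s K(r, s) / (φ(r) φ(s))` in the `y`-variables.  Maynard diagonalises these with the
auxiliary variables `u_i`, `s_{i,j}` ((5.5)–(5.7), (5.20)–(5.23)); that printed diagonalisation is
formalised, for an arbitrary `y` on the box `[1, B]^k` (tuples of integers), in
`MaynardSieveBilinear.lean` (`Literature.NumberTheory.Sieve.MaynardSieve.abs_S1main_sub_le`, `abs_S2main_sub_le`), which serves
the named facts `maynard_lemma51` / `maynard_S1_asymptotic` of `MaynardSieveS1.lean`,
`MaynardSieve.lean` (the `D₀ = log log log N → ∞` route to Theorem B).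

This file belongs to the second, *fixed-`D₀`* route to the smooth-`F` theorem
`Literature.NumberTheory.Sieve.frequently_card_primes_ge_of_maynardFunctional_smooth` in the functional-finset encoding of
`MaynardSieveTuples.lean` (sequels `MaynardSieveTupleS1.lean`, `MaynardSieveTupleS2.lean`): there the
quadratic forms are indexed by pairs of support tuples `A, A'` given as finsets of (prime, index)
pairs, and instead of the `u_i, s_{i,j}` variables the kernel is factorised PRIME BY PRIME, which (i)
gives the error constants `8k²/D₀`, `24(k+1)²/D₀` directly by "peeling" one mismatched prime
(no `Z^{k²−k} − 1` products), and (ii) for `S₂^{(m)}` produces the main term directly as a sum over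
"good pairs" (`r, r'` equal off the index `m`) with the weights `(p² − p − 1)/(p − 1)³`, `1/(p − 1)` —
i.e. it bypasses the variables `y^{(m)}` and Lemma 5.3 altogether, a form the bilinear file does not
provide and which feeds the `(k+1)`-dimensional equidistribution lemma of `MaynardEquidistribution.lean`.
Neither encoding's statements are corollaries of the other's without a dictionary between
`Fin k → ℕ` tuples and functional finsets (`MaynardSieveTuples.rad/ofNat`), so the kernel algebra is
redone here in the finset encoding (about 150 lines: `kernel_eq_prod_kernelLoc`). Contents:

* `kernel d A A'` — for support tuples `A, A'` (encoded as functional finsets of (prime, index)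
  pairs, `MaynardSieveTuples`), the sum over divisor tuples `B ⊆ A`, `C ⊆ A'` with `B ∪ C` again a
  tuple (the compatibility forced by the Chinese remainder theorem) of
  `μ(B) μ(C) (∏B)(∏C) / ∏_{p ∣ [B, C]} d(p)`;
* `kernel_eq_prod_kernelLoc` (**main result**): `kernel d A A' = ∏_{p} kernelLoc d A A' p` over the
  primes of `A ∪ A'`, with the local factor
  `kernelLoc d A A' p = 1 − [p ∣ r] p/d(p) − [p ∣ r'] p/d(p) + [p ∣ r, r' with equal index] p²/d(p)`
  (so for `d(p) = p`: `0` if `p` divides only one of `r, r'`, `p − 1` for equal indices, `−1` for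
  different indices; for `d(p) = p − 1` the values `−1/(p−1)`, `(p² − p − 1)/(p − 1)`,
  `−(p + 1)/(p − 1)`), proved through the double power-set identity
  `∑_{β, γ ⊆ V} ∏_{p ∈ V} f_p([p ∈ β], [p ∈ γ]) = ∏_{p ∈ V} ∑_{b, c} f_p(b, c)`;
* `sum_filter_le_of_peel`, `sum_filter_le_of_peel_of_le_half` — the abstract "peeling" inequality
  by which the contributions of primes with mismatched indices (Maynard's `s_{i,j} > D₀`, (5.14),
  (5.22), and the non-coprime tuples of (6.7)) are bounded by `O(k²/D₀)` times the main term.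

## References

* J. Maynard, *Small gaps between primes*, Ann. of Math. (2) 181 (2015), 383–413,
  doi:10.4007/annals.2015.181.1.7 = arXiv:1311.4600; proofs of Lemmas 5.1, 5.2, displays
  (5.3)–(5.7), (5.14), (5.20)–(5.23), (6.7). [cite: MaynardAnnals2015]
-/

open Finset

namespace Literature.NumberTheory.Sieve
namespace MaynardTao

variable {k : ℕ}

/-! ### The double power-set identity -/

/-- Splitting a product over `V` according to membership in `γ ⊆ V`. [folklore] -/
theorem prod_decide_mem_eq_mul_prod_sdiff {V γ : Finset ℕ} (hγ : γ ⊆ V) (h : ℕ → Bool → ℝ) :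
    ∏ p ∈ V, h p (decide (p ∈ γ)) = (∏ p ∈ γ, h p true) * ∏ p ∈ V \ γ, h p false := by
  rw [← Finset.prod_sdiff hγ, mul_comm]
  congr 1
  · exact Finset.prod_congr rfl fun p hp => by rw [decide_eq_true hp]
  · exact Finset.prod_congr rfl fun p hp => by rw [decide_eq_false (Finset.mem_sdiff.1 hp).2]

/-- `∑_{γ ⊆ V} ∏_{p ∈ V} h_p([p ∈ γ]) = ∏_{p ∈ V} (h_p(1) + h_p(0))`. [folklore] -/
theorem sum_powerset_prod_bool (V : Finset ℕ) (h : ℕ → Bool → ℝ) :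
    ∑ γ ∈ V.powerset, ∏ p ∈ V, h p (decide (p ∈ γ)) = ∏ p ∈ V, (h p true + h p false) := by
  rw [Finset.prod_add]
  exact Finset.sum_congr rfl fun γ hγ => prod_decide_mem_eq_mul_prod_sdiff (Finset.mem_powerset.1 hγ) h

/-- **Double power-set identity**:
`∑_{β ⊆ V} ∑_{γ ⊆ V} ∏_{p ∈ V} f_p([p ∈ β], [p ∈ γ]) = ∏_{p ∈ V} ∑_{b, c} f_p(b, c)`. [folklore] -/
theorem sum_powerset_sum_powerset_prod (V : Finset ℕ) (f : ℕ → Bool → Bool → ℝ) :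
    ∑ β ∈ V.powerset, ∑ γ ∈ V.powerset, ∏ p ∈ V, f p (decide (p ∈ β)) (decide (p ∈ γ)) =
      ∏ p ∈ V, (f p true true + f p true false + (f p false true + f p false false)) := by
  have inner : ∀ β ∈ V.powerset,
      ∑ γ ∈ V.powerset, ∏ p ∈ V, f p (decide (p ∈ β)) (decide (p ∈ γ)) =
        ∏ p ∈ V, (f p (decide (p ∈ β)) true + f p (decide (p ∈ β)) false) :=
    fun β _ => sum_powerset_prod_bool V fun p c => f p (decide (p ∈ β)) c
  rw [Finset.sum_congr rfl inner]
  exact sum_powerset_prod_bool V fun p b => f p b true + f p b false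

/-! ### Sub-finsets of a functional finset are indexed by sets of primes -/

/-- The restriction of `A` to the primes in `β`. [folklore] -/
def restr (A : Finset (ℕ × Fin k)) (β : Finset ℕ) : Finset (ℕ × Fin k) := A.filter fun x => x.1 ∈ β

/-- `A|_β ⊆ A`. [folklore] -/
theorem restr_subset (A : Finset (ℕ × Fin k)) (β : Finset ℕ) : restr A β ⊆ A := Finset.filter_subset _ _

/-- Membership in `A|_β`. [folklore] -/
theorem mem_restr {A : Finset (ℕ × Fin k)} {β : Finset ℕ} {x : ℕ × Fin k} :
    x ∈ restr A β ↔ x ∈ A ∧ x.1 ∈ β := Finset.mem_filter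

/-- `A|_{primes of B} = B` for `B ⊆ A`, `A` functional. [folklore] -/
theorem restr_image_fst {A B : Finset (ℕ × Fin k)} (hA : IsFunctional A) (hB : B ⊆ A) :
    restr A (B.image Prod.fst) = B := by
  ext x
  rw [mem_restr, Finset.mem_image]
  constructor
  · rintro ⟨hx, y, hy, hyx⟩
    rwa [hA x hx y (hB hy) hyx.symm]
  · intro hx
    exact ⟨hB hx, x, hx, rfl⟩

/-- The primes of `A|_β` are `β` (for `β` a set of primes of `A`). [folklore] -/
theorem image_fst_restr {A : Finset (ℕ × Fin k)} {β : Finset ℕ} (hβ : β ⊆ A.image Prod.fst) :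
    (restr A β).image Prod.fst = β := by
  ext p
  rw [Finset.mem_image]
  constructor
  · rintro ⟨x, hx, rfl⟩
    exact (mem_restr.1 hx).2
  · intro hp
    obtain ⟨x, hx, rfl⟩ := Finset.mem_image.1 (hβ hp)
    exact ⟨x, mem_restr.2 ⟨hx, hp⟩, rfl⟩

/-- **Reindexing**: sub-finsets of a functional `A` ↔ subsets of its set of primes. [folklore] -/
theorem sum_powerset_eq_sum_powerset_image {A : Finset (ℕ × Fin k)} (hA : IsFunctional A)
    (G : Finset (ℕ × Fin k) → ℝ) :
    ∑ B ∈ A.powerset, G B = ∑ β ∈ (A.image Prod.fst).powerset, G (restr A β) := by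
  refine Finset.sum_nbij' (fun B => B.image Prod.fst) (fun β => restr A β) ?_ ?_ ?_ ?_ ?_
  · intro B hB
    exact Finset.mem_powerset.2 (Finset.image_subset_image (Finset.mem_powerset.1 hB))
  · intro β _
    exact Finset.mem_powerset.2 (restr_subset A β)
  · intro B hB
    exact restr_image_fst hA (Finset.mem_powerset.1 hB)
  · intro β hβ
    exact image_fst_restr (Finset.mem_powerset.1 hβ)
  · intro B hB
    rw [restr_image_fst hA (Finset.mem_powerset.1 hB)]

/-- Products over a functional finset of pairs are products over its primes. [folklore] -/
theorem prod_eq_prod_image_fst {B : Finset (ℕ × Fin k)} (hB : IsFunctional B) (g : ℕ → ℝ) :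
    ∏ x ∈ B, g x.1 = ∏ p ∈ B.image Prod.fst, g p := by
  rw [Finset.prod_image]
  exact fun x hx y hy hxy => hB x hx y hy hxy

/-- A functional finset has as many pairs as primes. [folklore] -/
theorem card_eq_card_image_fst {B : Finset (ℕ × Fin k)} (hB : IsFunctional B) :
    B.card = (B.image Prod.fst).card :=
  (Finset.card_image_of_injOn fun x hx y hy hxy => hB x hx y hy hxy).symm

/-! ### The kernel and its local factors -/

/-- The kernel of the quadratic form in the `y`-variables obtained by expanding
`∑ λ_d λ_e / f([d, e])` (Maynard 2015, proofs of Lemmas 5.1–5.2): for a pair of support tuples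
`A, A'`, the sum over divisor tuples `B ⊆ A`, `C ⊆ A'` with `B ∪ C` again a tuple (the compatibility
forced by the Chinese remainder theorem) of `μ(B) μ(C) (∏B)(∏C) / ∏_{p ∣ [B,C]} d(p)`; `d(p) = p`
for `S₁` and `d(p) = p − 1` for `S₂`. [cite: MaynardAnnals2015, proof of Lemma 5.1, (5.3)–(5.6)] -/
noncomputable def kernel (d : ℕ → ℝ) (A A' : Finset (ℕ × Fin k)) : ℝ :=
  ∑ B ∈ A.powerset, ∑ C ∈ A'.powerset,
    if IsFunctional (B ∪ C) then
      (-1 : ℝ) ^ B.card * (-1 : ℝ) ^ C.card * ((∏ x ∈ B, (x.1 : ℝ)) * ∏ x ∈ C, (x.1 : ℝ)) /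
        ∏ p ∈ (B ∪ C).image Prod.fst, d p
    else 0

/-- The local factor of the kernel at the prime `p`:
`1 − [p ∣ r] p/d(p) − [p ∣ r'] p/d(p) + [p ∣ r, p ∣ r' with the same index] p²/d(p)`.
[cite: MaynardAnnals2015, proof of Lemma 5.1, (5.5)] -/
noncomputable def kernelLoc (d : ℕ → ℝ) (A A' : Finset (ℕ × Fin k)) (p : ℕ) : ℝ :=
  1 - (if p ∈ A.image Prod.fst then (p : ℝ) / d p else 0)
    - (if p ∈ A'.image Prod.fst then (p : ℝ) / d p else 0)
    + (if p ∈ (A ∩ A').image Prod.fst then (p : ℝ) ^ 2 / d p else 0)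

section kernel

variable {A A' : Finset (ℕ × Fin k)} (hA : IsFunctional A) (hA' : IsFunctional A') (d : ℕ → ℝ)
include hA hA'

/-- Compatibility of `B = A|_β` and `C = A'|_γ`: `B ∪ C` is functional iff every common prime of
`β` and `γ` carries the same index in `A` and `A'`. [folklore] -/
theorem isFunctional_union_restr_iff {β γ : Finset ℕ} (hβ : β ⊆ A.image Prod.fst)
    (hγ : γ ⊆ A'.image Prod.fst) :
    IsFunctional (restr A β ∪ restr A' γ) ↔ β ∩ γ ⊆ (A ∩ A').image Prod.fst := by
  constructor
  · intro hf p hp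
    rw [Finset.mem_inter] at hp
    obtain ⟨x, hx, rfl⟩ := Finset.mem_image.1 (hβ hp.1)
    obtain ⟨y, hy, hyx⟩ := Finset.mem_image.1 (hγ hp.2)
    have hxB : x ∈ restr A β ∪ restr A' γ := Finset.mem_union_left _ (mem_restr.2 ⟨hx, hp.1⟩)
    have hyC : y ∈ restr A β ∪ restr A' γ :=
      Finset.mem_union_right _ (mem_restr.2 ⟨hy, hyx.symm ▸ hp.2⟩)
    have := hf x hxB y hyC hyx.symm
    subst this
    exact Finset.mem_image.2 ⟨x, Finset.mem_inter.2 ⟨hx, hy⟩, rfl⟩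
  · intro hS x hx y hy hxy
    rw [Finset.mem_union, mem_restr, mem_restr] at hx hy
    -- a common prime of `β` and `γ` has a unique pair in `A ∩ A'`
    have key : ∀ x y : ℕ × Fin k, x ∈ A → x.1 ∈ β → y ∈ A' → y.1 ∈ γ → x.1 = y.1 → x = y := by
      intro x y hxA hxβ hyA hyγ hxy
      have hp : x.1 ∈ β ∩ γ := Finset.mem_inter.2 ⟨hxβ, hxy ▸ hyγ⟩
      obtain ⟨z, hz, hzx⟩ := Finset.mem_image.1 (hS hp)
      rw [Finset.mem_inter] at hz
      have h1 := hA x hxA z hz.1 hzx.symm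
      have h2 := hA' y hyA z hz.2 (hxy ▸ hzx).symm
      rw [h1, h2]
    rcases hx with hx | hx <;> rcases hy with hy | hy
    · exact hA x hx.1 y hy.1 hxy
    · exact key x y hx.1 hx.2 hy.1 hy.2 hxy
    · exact (key y x hy.1 hy.2 hx.1 hx.2 hxy.symm).symm
    · exact hA' x hx.1 y hy.1 hxy

/-- The local weight `f_p(b, c)` whose double power-set sum is the kernel. [folklore] -/
noncomputable def kernelF (d : ℕ → ℝ) (A A' : Finset (ℕ × Fin k)) (p : ℕ) (b c : Bool) : ℝ :=
  (if b then (if p ∈ A.image Prod.fst then -(p : ℝ) else 0) else 1) *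
    (if c then (if p ∈ A'.image Prod.fst then -(p : ℝ) else 0) else 1) /
    (if b || c then d p else 1) *
    (if b && c then (if p ∈ (A ∩ A').image Prod.fst then 1 else 0) else 1)

/-- The summand of the kernel at `(A|_β, A'|_γ)` is `∏_p f_p([p ∈ β], [p ∈ γ])`. [folklore] -/
theorem kernel_summand_eq_prod {β γ : Finset ℕ} (hβ : β ⊆ A.image Prod.fst)
    (hγ : γ ⊆ A'.image Prod.fst) :
    (if IsFunctional (restr A β ∪ restr A' γ) then
      (-1 : ℝ) ^ (restr A β).card * (-1 : ℝ) ^ (restr A' γ).card *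
        ((∏ x ∈ restr A β, (x.1 : ℝ)) * ∏ x ∈ restr A' γ, (x.1 : ℝ)) /
        ∏ p ∈ (restr A β ∪ restr A' γ).image Prod.fst, d p
      else 0) =
    ∏ p ∈ (A ∪ A').image Prod.fst, kernelF d A A' p (decide (p ∈ β)) (decide (p ∈ γ)) := by
  set V := (A ∪ A').image Prod.fst with hV
  set S := (A ∩ A').image Prod.fst with hS
  have hβV : β ⊆ V := hβ.trans (Finset.image_subset_image Finset.subset_union_left)
  have hγV : γ ⊆ V := hγ.trans (Finset.image_subset_image Finset.subset_union_right)
  have hfB : IsFunctional (restr A β) := hA.subset (restr_subset _ _)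
  have hfC : IsFunctional (restr A' γ) := hA'.subset (restr_subset _ _)
  -- the four factor products
  have h1 : ∏ p ∈ V, (if decide (p ∈ β) then (if p ∈ A.image Prod.fst then -(p : ℝ) else 0) else 1) =
      (-1 : ℝ) ^ (restr A β).card * ∏ x ∈ restr A β, (x.1 : ℝ) := by
    rw [card_eq_card_image_fst hfB, prod_eq_prod_image_fst hfB (fun p => (p : ℝ)),
      image_fst_restr hβ, Finset.pow_card_mul_prod]
    have : ∀ p ∈ V, (if decide (p ∈ β) then (if p ∈ A.image Prod.fst then -(p : ℝ) else 0) else 1) =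
        if p ∈ β then -(p : ℝ) else 1 := by
      intro p _
      by_cases hp : p ∈ β
      · rw [decide_eq_true hp, if_pos rfl, if_pos (hβ hp), if_pos hp]  -- `if true = true`
      · rw [decide_eq_false hp, if_neg hp, if_neg Bool.false_ne_true]
    rw [Finset.prod_congr rfl this, Finset.prod_ite_mem, Finset.inter_eq_right.2 hβV]
    exact Finset.prod_congr rfl fun p _ => by rw [neg_one_mul]
  have h2 : ∏ p ∈ V, (if decide (p ∈ γ) then (if p ∈ A'.image Prod.fst then -(p : ℝ) else 0) else 1) =
      (-1 : ℝ) ^ (restr A' γ).card * ∏ x ∈ restr A' γ, (x.1 : ℝ) := by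
    rw [card_eq_card_image_fst hfC, prod_eq_prod_image_fst hfC (fun p => (p : ℝ)),
      image_fst_restr hγ, Finset.pow_card_mul_prod]
    have : ∀ p ∈ V, (if decide (p ∈ γ) then (if p ∈ A'.image Prod.fst then -(p : ℝ) else 0) else 1) =
        if p ∈ γ then -(p : ℝ) else 1 := by
      intro p _
      by_cases hp : p ∈ γ
      · rw [decide_eq_true hp, if_pos rfl, if_pos (hγ hp), if_pos hp]
      · rw [decide_eq_false hp, if_neg hp, if_neg Bool.false_ne_true]
    rw [Finset.prod_congr rfl this, Finset.prod_ite_mem, Finset.inter_eq_right.2 hγV]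
    exact Finset.prod_congr rfl fun p _ => by rw [neg_one_mul]
  have h3 : ∏ p ∈ V, (if (decide (p ∈ β) || decide (p ∈ γ)) then d p else 1) =
      ∏ p ∈ (restr A β ∪ restr A' γ).image Prod.fst, d p := by
    rw [Finset.image_union, image_fst_restr hβ, image_fst_restr hγ]
    have : ∀ p ∈ V, (if (decide (p ∈ β) || decide (p ∈ γ)) then d p else 1) =
        if p ∈ β ∪ γ then d p else 1 := by
      intro p _
      congr 1
      simp only [Bool.or_eq_true, decide_eq_true_eq, Finset.mem_union]
    rw [Finset.prod_congr rfl this, Finset.prod_ite_mem,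
      Finset.inter_eq_right.2 (Finset.union_subset hβV hγV)]
  have h4 : ∏ p ∈ V, (if (decide (p ∈ β) && decide (p ∈ γ)) then (if p ∈ S then (1:ℝ) else 0) else 1) =
      if β ∩ γ ⊆ S then 1 else 0 := by
    have : ∀ p ∈ V, (if (decide (p ∈ β) && decide (p ∈ γ)) then (if p ∈ S then (1:ℝ) else 0) else 1) =
        if p ∈ β ∩ γ then (if p ∈ S then (1:ℝ) else 0) else 1 := by
      intro p _
      congr 1
      simp only [Bool.and_eq_true, decide_eq_true_eq, Finset.mem_inter]
    rw [Finset.prod_congr rfl this, Finset.prod_ite_mem,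
      Finset.inter_eq_right.2 ((Finset.inter_subset_left).trans hβV)]
    split_ifs with hsub
    · exact Finset.prod_eq_one fun p hp => if_pos (hsub hp)
    · obtain ⟨p, hp, hpS⟩ := Finset.not_subset.1 hsub
      exact Finset.prod_eq_zero hp (if_neg hpS)
  -- assemble
  simp only [kernelF]
  rw [Finset.prod_mul_distrib, Finset.prod_div_distrib, Finset.prod_mul_distrib, h1, h2, h3, ← hS, h4]
  by_cases hf : IsFunctional (restr A β ∪ restr A' γ)
  · rw [if_pos hf, if_pos ((isFunctional_union_restr_iff hA hA' hβ hγ).1 hf)]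
    ring
  · rw [if_neg hf, if_neg (fun h => hf ((isFunctional_union_restr_iff hA hA' hβ hγ).2 h))]
    simp

/-- **Kernel factorisation** (Maynard 2015, the multiplicativity behind (5.5)–(5.6) and
(5.20)–(5.23)): for functional `A, A'`,
`kernel d A A' = ∏_{p ∈ primes of A ∪ A'} kernelLoc d A A' p`. [cite: MaynardAnnals2015, proof of Lemma 5.1] -/
theorem kernel_eq_prod_kernelLoc :
    kernel d A A' = ∏ p ∈ (A ∪ A').image Prod.fst, kernelLoc d A A' p := by
  set V := (A ∪ A').image Prod.fst with hV
  have hAV : A.image Prod.fst ⊆ V := Finset.image_subset_image Finset.subset_union_left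
  have hA'V : A'.image Prod.fst ⊆ V := Finset.image_subset_image Finset.subset_union_right
  -- Step 1: reindex by sets of primes and put the summand in product form
  have step1 : kernel d A A' = ∑ β ∈ (A.image Prod.fst).powerset, ∑ γ ∈ (A'.image Prod.fst).powerset,
      ∏ p ∈ V, kernelF d A A' p (decide (p ∈ β)) (decide (p ∈ γ)) := by
    rw [kernel, sum_powerset_eq_sum_powerset_image hA]
    refine Finset.sum_congr rfl fun β hβ => ?_
    rw [sum_powerset_eq_sum_powerset_image hA']
    refine Finset.sum_congr rfl fun γ hγ => ?_
    exact kernel_summand_eq_prod hA hA' d (Finset.mem_powerset.1 hβ) (Finset.mem_powerset.1 hγ)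
  -- Step 2: extend the sums to all subsets of `V` (the new terms vanish)
  have hzero1 : ∀ β ∈ V.powerset, β ∉ (A.image Prod.fst).powerset → ∀ γ : Finset ℕ,
      ∏ p ∈ V, kernelF d A A' p (decide (p ∈ β)) (decide (p ∈ γ)) = 0 := by
    intro β hβ hβA γ
    rw [Finset.mem_powerset, Finset.not_subset] at hβA
    obtain ⟨p, hpβ, hpA⟩ := hβA
    refine Finset.prod_eq_zero (Finset.mem_powerset.1 hβ hpβ) ?_
    simp [kernelF, hpβ, hpA]
  have hzero2 : ∀ β : Finset ℕ, ∀ γ ∈ V.powerset, γ ∉ (A'.image Prod.fst).powerset →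
      ∏ p ∈ V, kernelF d A A' p (decide (p ∈ β)) (decide (p ∈ γ)) = 0 := by
    intro β γ hγ hγA
    rw [Finset.mem_powerset, Finset.not_subset] at hγA
    obtain ⟨p, hpγ, hpA⟩ := hγA
    refine Finset.prod_eq_zero (Finset.mem_powerset.1 hγ hpγ) ?_
    simp [kernelF, hpγ, hpA]
  have step2 : ∑ β ∈ (A.image Prod.fst).powerset, ∑ γ ∈ (A'.image Prod.fst).powerset,
      ∏ p ∈ V, kernelF d A A' p (decide (p ∈ β)) (decide (p ∈ γ)) =
      ∑ β ∈ V.powerset, ∑ γ ∈ V.powerset,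
        ∏ p ∈ V, kernelF d A A' p (decide (p ∈ β)) (decide (p ∈ γ)) := by
    rw [Finset.sum_subset (Finset.powerset_mono.2 hAV)]
    · refine Finset.sum_congr rfl fun β _ => ?_
      exact Finset.sum_subset (Finset.powerset_mono.2 hA'V) fun γ hγ hγA => hzero2 β γ hγ hγA
    · intro β hβ hβA
      exact Finset.sum_eq_zero fun γ _ => hzero1 β hβ hβA γ
  -- Step 3: the double power-set identity and the local sums
  rw [step1, step2, sum_powerset_sum_powerset_prod]
  refine Finset.prod_congr rfl fun p _ => ?_
  have hSsub : p ∈ (A ∩ A').image Prod.fst → p ∈ A.image Prod.fst ∧ p ∈ A'.image Prod.fst := by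
    intro h
    obtain ⟨x, hx, rfl⟩ := Finset.mem_image.1 h
    rw [Finset.mem_inter] at hx
    exact ⟨Finset.mem_image.2 ⟨x, hx.1, rfl⟩, Finset.mem_image.2 ⟨x, hx.2, rfl⟩⟩
  have eTT : kernelF d A A' p true true =
      (if p ∈ A.image Prod.fst then -(p : ℝ) else 0) * (if p ∈ A'.image Prod.fst then -(p : ℝ) else 0) /
        d p * (if p ∈ (A ∩ A').image Prod.fst then 1 else 0) := by
    simp [kernelF]
  have eTF : kernelF d A A' p true false = (if p ∈ A.image Prod.fst then -(p : ℝ) else 0) / d p := by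
    simp [kernelF]
  have eFT : kernelF d A A' p false true = (if p ∈ A'.image Prod.fst then -(p : ℝ) else 0) / d p := by
    simp [kernelF]
  have eFF : kernelF d A A' p false false = 1 := by simp [kernelF]
  rw [eTT, eTF, eFT, eFF, kernelLoc]
  by_cases h3 : p ∈ (A ∩ A').image Prod.fst
  · obtain ⟨h1, h2⟩ := hSsub h3
    simp only [h1, h2, h3, if_true]
    ring
  · by_cases h1 : p ∈ A.image Prod.fst <;> by_cases h2 : p ∈ A'.image Prod.fst <;>
      simp only [h1, h2, h3, if_true, if_false] <;> ring

end kernel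

/-! ### The peeling inequality -/

/-- **Peeling inequality** (abstract form of the bounds (5.14), (5.22), (6.7) of Maynard 2015: a sum
over configurations containing at least one "bad" prime is at most
`(∑_{bad local data} local weight) ×` the full sum): let `w ≥ 0` on a finite set `P`, and suppose
every bad `x ∈ P` can be *peeled* to `peel x ∈ P` with `w x ≤ c(key x) · w(peel x)`, injectively on
each fibre of `key`. Then `∑_{x ∈ P, bad} w x ≤ (∑_κ c κ) ∑_{x ∈ P} w x`.
[cite: MaynardAnnals2015, proof of Lemma 5.1, (5.14)] -/
theorem sum_filter_le_of_peel {X K : Type*} [DecidableEq X] [DecidableEq K]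
    (P : Finset X) (bad : X → Prop) [DecidablePred bad] (w : X → ℝ) (hw : ∀ x ∈ P, 0 ≤ w x)
    (Kset : Finset K) (c : K → ℝ) (hc : ∀ κ ∈ Kset, 0 ≤ c κ) (key : X → K) (peel : X → X)
    (hkey : ∀ x ∈ P, bad x → key x ∈ Kset)
    (hpeel : ∀ x ∈ P, bad x → peel x ∈ P)
    (hwle : ∀ x ∈ P, bad x → w x ≤ c (key x) * w (peel x))
    (hinj : ∀ κ ∈ Kset, Set.InjOn peel {x | x ∈ P ∧ bad x ∧ key x = κ}) :
    ∑ x ∈ P.filter bad, w x ≤ (∑ κ ∈ Kset, c κ) * ∑ x ∈ P, w x := by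
  have htot : 0 ≤ ∑ x ∈ P, w x := Finset.sum_nonneg hw
  -- decompose the bad sum along the fibres of `key`
  rw [← Finset.sum_fiberwise_of_maps_to (g := key) (t := Kset)
    (fun x hx => hkey x (Finset.mem_filter.1 hx).1 (Finset.mem_filter.1 hx).2), Finset.sum_mul]
  refine Finset.sum_le_sum fun κ hκ => ?_
  set Fκ := (P.filter bad).filter (fun x => key x = κ) with hF
  calc ∑ x ∈ Fκ, w x ≤ ∑ x ∈ Fκ, c κ * w (peel x) := by
        refine Finset.sum_le_sum fun x hx => ?_
        rw [hF, Finset.mem_filter, Finset.mem_filter] at hx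
        rw [← hx.2]
        exact hwle x hx.1.1 hx.1.2
    _ = c κ * ∑ x ∈ Fκ, w (peel x) := by rw [Finset.mul_sum]
    _ = c κ * ∑ y ∈ Fκ.image peel, w y := by
        rw [Finset.sum_image]
        intro x hx y hy hxy
        rw [hF, Finset.coe_filter] at hx hy
        simp only [Finset.mem_filter, Set.mem_setOf_eq] at hx hy
        exact hinj κ hκ ⟨hx.1.1, hx.1.2, hx.2⟩ ⟨hy.1.1, hy.1.2, hy.2⟩ hxy
    _ ≤ c κ * ∑ y ∈ P, w y := by
        refine mul_le_mul_of_nonneg_left ?_ (hc κ hκ)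
        refine Finset.sum_le_sum_of_subset_of_nonneg ?_ fun y hy _ => hw y hy
        intro y hy
        obtain ⟨x, hx, rfl⟩ := Finset.mem_image.1 hy
        rw [hF, Finset.mem_filter, Finset.mem_filter] at hx
        exact hpeel x hx.1.1 hx.1.2

/-- **Absorbing the peeled sum**: if moreover `∑_κ c κ ≤ 1/2` then the bad part is at most
`2 (∑_κ c κ)` times the good part. [folklore] -/
theorem sum_filter_le_of_peel_of_le_half {X : Type*} [DecidableEq X] (P : Finset X)
    (bad : X → Prop) [DecidablePred bad] (w : X → ℝ) (hw : ∀ x ∈ P, 0 ≤ w x) {s : ℝ}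
    (hs : s ≤ 1 / 2) (h : ∑ x ∈ P.filter bad, w x ≤ s * ∑ x ∈ P, w x) :
    ∑ x ∈ P.filter bad, w x ≤ 2 * s * ∑ x ∈ P.filter (fun x => ¬bad x), w x := by
  have hsplit := Finset.sum_filter_add_sum_filter_not P bad w
  have hgood : 0 ≤ ∑ x ∈ P.filter (fun x => ¬bad x), w x :=
    Finset.sum_nonneg fun x hx => hw x (Finset.mem_filter.1 hx).1
  have hbad : 0 ≤ ∑ x ∈ P.filter bad, w x :=
    Finset.sum_nonneg fun x hx => hw x (Finset.mem_filter.1 hx).1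
  rw [← hsplit] at h
  -- `B ≤ s (B + G)` with `s ≤ 1/2` gives `B ≤ 2 s G`
  by_cases hs0 : s ≤ 0
  · have : ∑ x ∈ P.filter bad, w x ≤ 0 := le_trans h (by nlinarith)
    have hB0 : ∑ x ∈ P.filter bad, w x = 0 := le_antisymm this hbad
    rw [hB0] at h ⊢
    nlinarith
  · have hs0' : 0 < s := lt_of_not_ge hs0
    nlinarith

end MaynardTao
end Literature.NumberTheory.Sieve
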